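import Summits.SmoothPoincare4.SmoothPoincare4.Theorems.ConvexBisectionAcyclicBisectionExistsHgapTwistRows
import HarnessLib

/-!
# N1 ▸ `node_N1_move` ▸ (d) N1-mono (the deep-belt monodromy model), brick H4-1:
# THE BELT MATRIX — the boundary open book of `X` is non-degenerate at a belt circle
(wave 7, crux stmt-SmoothPoincare4-10508, line `modp-braid-orbits`, registered stub `stub_M2geo` (N1) ▸
`node_N1_move` ▸ sub-node (d); registered sub-goal `helper_beltMatrix_nondegenerate`)

Let `β♭ = (beltMap D j).boundaryTube` be the belt tube of the `j`-th handle of `X = Base g ∪_{h̄} (handles)`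
(core = belt circle, fibre coordinate `m = x_λ`), `seam` the seam diffeomorphism `∂X ≅ ∂ Base g` of a
fibred model `(D, bX, Ψ)`, `R₁` any smooth self-map of `Base g` rescaling `w` positively (e.g. `id`, or
the time-one map of a fibred straightening), and

    Θ̂_θ (m) := S_c (w (R₁ (seam (β♭ (θ, m)))))        (`S_c z = Im (c̄ z) / Re (c̄ z)`, the page slope)

the boundary open book `θ_X = arg w ∘ Ψ` of `X` near the belt circle, read through the seam in the belt
chart.  G2 (`…HgapTwistRadial.lean`) computed its radial derivatives at the belt circle under a FLATNESS
hypothesis `w (R₁ (seam (β♭ (θ, 0)))) = c/2`.  This file removes that hypothesis — only the RAY condition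
`w (R₁ (seam (β♭ (θ, 0)))) ∈ ℝ_{>0} · c` (the belt clause of the fibred model) is needed, since the page
slope is blind to radial rescaling (§1) — and packages the first-order structure as ONE matrix (§2–§3):

* §2 **the belt matrix** (`exists_beltMatrix`): there is `M : ℝ² →L ℝ²` with
  `dΘ̂_θ (0) · v = ⟪M θ, v⟫` for all belt-circle points `θ` and unit `v`, and
  `⟪M θ, v⟫ = 4 ‖dΦ_{K v}‖² ⟪D_v θ, n (K v)⟫` (`D_v` the fibre derivative of the ATTACHING tube at the
  core point `v`): the two rigidities "linear in `v`" (G2, sphere side) and "linear in `θ`" (tube side)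
  assemble into a bilinear form;
* §3 **non-degeneracy** (`beltRow_ne_zero`, registered `helper_beltMatrix_nondegenerate`): `M` is
  invertible.  Through Z4's page tube `Φ` around the
  attaching circle (`helper_exists_pageTube`) the functional `θ ↦ ⟪M θ, v⟫` is `κ` times the second ROW of
  the transition matrix `A(v) = CircleTube.fibreDeriv f♭ Φ v` (G2 `beltRow_eq_pageTube`), which is
  invertible (`CircleTube.injective_fibreDeriv`); so every `v` pairs non-trivially with `range M`, and
  `M` is onto, hence one-to-one.

Consequently `θ_X` is a SUBMERSION along the belt circle with differential `(δθ, δm) ↦ ⟪M θ, δm⟫` in the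
belt chart (its `θ`-derivative vanishes there by the belt clause): the linearised deep-belt model
`Θ_X (θ, m) ≈ ⟪M θ, m⟫` on which the two-sided fibred belt chart of (d) (`work/stubs/H4H7_interface.lean`)
is built.  Everything is proved; no named facts, no `sorry`.  References: A. A. Kosinski, *Differential
Manifolds* (1993), VI §6 [Kosinski1993]; J. B. Etnyre, T. Fuller, IMRN 2006, Thm. 1 (proof, p. 8)
[EtnyreFuller2006].
-/

noncomputable section

set_option linter.dupNamespace false

open scoped Manifold ContDiff Topology ComplexConjugate
open Set Function Metric Complex Filter
open Literature.Topology.FourManifolds Literature.Topology.FourManifolds.HandleAttachingMap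
  Literature.Topology.FourManifolds.LefschetzBase Literature.Geometry.Symplectic

namespace Summit.SmoothPoincare4.SmoothPoincare4.Theorems.AcyclicBisectionExists.ModpBraidOrbits

variable {g : ℕ} {ι : Type} [Finite ι] {h : ι → HandleAttachingMap 3 2 (Base g)}
  {X : Type} [TopologicalSpace X] [ChartedSpace (EuclideanHalfSpace 4) X] [IsManifold (𝓡∂ 4) ∞ X]
  (D : MultiAttachmentData h (𝓡∂ 4) X) (bX : BoundaryData (𝓡∂ 4) X (𝓡 3))
  (Ψ : bX.carrier ≃ₘ⟮𝓡 3, 𝓡 3⟯ (bBase g).carrier)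

/-! ## §1 The radial derivative of the belt slope under the ray condition -/

/-- On the ray `ℝ_{>0} · c` the page slope vanishes and its denominator is positive:
`Re (c̄ (t c)) = t`, `Im (c̄ (t c)) = 0` for `‖c‖ = 1`. [folklore] -/
theorem conj_mul_ray {c : ℂ} (hc : ‖c‖ = 1) (t : ℝ) :
    (conj c * ((t : ℂ) * c)).re = t ∧ (conj c * ((t : ℂ) * c)).im = 0 := by
  have e : conj c * ((t : ℂ) * c) = (t : ℂ) * ((Complex.normSq c : ℝ) : ℂ) := by
    rw [Complex.normSq_eq_conj_mul_self]; ring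
  have hn : Complex.normSq c = 1 := by rw [Complex.normSq_eq_norm_sq, hc, one_pow]
  rw [e, hn]
  simp

/-- **The radial derivative of the belt slope under the RAY condition** (G2's `fderiv_beltSlope_radial`
with the flatness hypothesis `w (Γ 0) = c/2` weakened to `w (Γ 0) = t · c`, `t > 0` — the form delivered
by the belt clause of a fibred model): for every belt-circle point `θ` and unit `v`,
`dΘ̂_θ (0) · v = 4 ‖dΦ_{K(v)}‖² ⟪D_v θ, n(K(v))⟫`.  Adapted from `fderiv_beltSlope_radial`
(`…HgapTwistRadial.lean`): the page slope only sees `arg w`. [cite: EtnyreFuller2006, Thm. 1 (proof, p. 8)] -/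
theorem fderiv_beltSlope_radial_of_ray
    (hpage : ∀ (y : bX.carrier) (a : ↥(coresComplement h)), bX.incl y = D.jA a →
      ∃ c : ℝ, 0 < c ∧ w g ((bBase g).incl (Ψ y)).1 = (c : ℂ) * w g (a : Base g).1)
    (j : ι) {c : ℂ} (hc : ‖c‖ = 1) (hKc : ∀ v, (h j).attachingCircle v ∈ page g c)
    {R₁ : Base g → Base g} (hR₁ : ContMDiff (𝓡∂ 4) (𝓡∂ 4) ∞ R₁)
    (hRw : ∀ x : Base g, ∃ t : ℝ, 0 < t ∧ w g (R₁ x).1 = (t : ℂ) * w g x.1)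
    (θ v : sphere (0 : EuclideanSpace ℝ (Fin 2)) 1)
    (hray : ∃ t : ℝ, 0 < t ∧ w g (R₁ ((BoundaryManifold.boundaryData 3 (Base g)).incl
      (seamDiffeo bX (bBase g) Ψ ((beltMap D j).boundaryTube.toHomeo
        (θ, (0 : EuclideanSpace ℝ (Fin 2))))))).1 = (t : ℂ) * c) :
    fderiv ℝ (fun m : EuclideanSpace ℝ (Fin 2) =>
        (conj c * w g (R₁ ((BoundaryManifold.boundaryData 3 (Base g)).incl (seamDiffeo bX (bBase g) Ψ
          ((beltMap D j).boundaryTube.toHomeo (θ, m))))).1).im /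
        (conj c * w g (R₁ ((BoundaryManifold.boundaryData 3 (Base g)).incl (seamDiffeo bX (bBase g) Ψ
          ((beltMap D j).boundaryTube.toHomeo (θ, m))))).1).re) 0 (v : EuclideanSpace ℝ (Fin 2)) =
      4 * (‖dPhiX g ((h j).attachingCircle v).1‖ ^ 2 + ‖dPhiY ((h j).attachingCircle v).1‖ ^ 2) *
        inner ℝ (fderiv ℝ (fun m' : EuclideanSpace ℝ (Fin 2) => ((h j).toFun (depthLine v m' 0)).1) 0
          (θ : EuclideanSpace ℝ (Fin 2))) (horizNormal g ((h j).attachingCircle v).1) := by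
  -- adapted from `fderiv_beltSlope_radial` (G2, `…HgapTwistRadial.lean`)
  set Γ : EuclideanSpace ℝ (Fin 2) → EuclideanSpace ℝ (Fin 4) := fun m =>
    (R₁ ((BoundaryManifold.boundaryData 3 (Base g)).incl (seamDiffeo bX (bBase g) Ψ
      ((beltMap D j).boundaryTube.toHomeo (θ, m))))).1 with hΓ
  set Th : EuclideanSpace ℝ (Fin 2) → ℝ := fun m =>
    (conj c * w g (Γ m)).im / (conj c * w g (Γ m)).re with hTh
  have hΓd : DifferentiableAt ℝ Γ 0 :=
    (contDiffAt_beltPushed D bX Ψ hR₁ j θ).differentiableAt (by simp)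
  obtain ⟨t₀, ht₀, hw0⟩ := hray
  have hw0' : w g (Γ 0) = (t₀ : ℂ) * c := hw0
  have hre0 : (conj c * w g (Γ 0)).re ≠ 0 := by
    rw [hw0', (conj_mul_ray hc t₀).1]; exact ht₀.ne'
  have hThd : DifferentiableAt ℝ Th 0 := differentiableAt_pageSlope_comp hΓd c hre0
  -- (a) along the ray `r ↦ r v`: the two-sided derivative of `Θ̂`
  have hrayd : HasDerivAt (fun r : ℝ => Th (r • (v : EuclideanSpace ℝ (Fin 2))))
      (fderiv ℝ Th 0 (v : EuclideanSpace ℝ (Fin 2))) 0 := by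
    have hl : HasDerivAt (fun r : ℝ => r • (v : EuclideanSpace ℝ (Fin 2)))
        (v : EuclideanSpace ℝ (Fin 2)) 0 := by
      simpa using (hasDerivAt_id (0 : ℝ)).smul_const (v : EuclideanSpace ℝ (Fin 2))
    exact hThd.hasFDerivAt.comp_hasDerivAt_of_eq (0 : ℝ) hl (by simp)
  -- (b) the attaching-tube side: the radial arc and its page slope
  set F : EuclideanSpace ℝ (Fin 2) → EuclideanSpace ℝ (Fin 4) := fun m' =>
    ((h j).toFun (depthLine v m' 0)).1 with hF
  have hFd : DifferentiableAt ℝ F 0 :=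
    (contDiffAt_attachingFibre (h j) v).differentiableAt (by simp)
  have hF0 : F 0 = ((h j).attachingCircle v).1 := by
    show ((h j).toFun (depthLine v 0 0)).1 = _
    rw [depthLine_zero_zero]; rfl
  have hwF : w g (F ((0 : ℝ) • (θ : EuclideanSpace ℝ (Fin 2)))) = c / 2 := by
    rw [zero_smul, hF0]; exact (hKc v).2
  have harc : HasDerivAt (fun r : ℝ => F (r • (θ : EuclideanSpace ℝ (Fin 2))))
      (fderiv ℝ F 0 (θ : EuclideanSpace ℝ (Fin 2))) 0 := by
    have hl : HasDerivAt (fun r : ℝ => r • (θ : EuclideanSpace ℝ (Fin 2)))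
        (θ : EuclideanSpace ℝ (Fin 2)) 0 := by
      simpa using (hasDerivAt_id (0 : ℝ)).smul_const (θ : EuclideanSpace ℝ (Fin 2))
    exact hFd.hasFDerivAt.comp_hasDerivAt_of_eq (0 : ℝ) hl (by simp)
  have hT := hasDerivAt_pageSlope_comp (g := g) harc hc hwF
  rw [zero_smul, hF0] at hT
  -- (c) the two slopes agree on `(0, 1)` and at `0`
  have hagree : ∀ r ∈ Ioo (0 : ℝ) 1, Th (r • (v : EuclideanSpace ℝ (Fin 2))) =
      (conj c * w g (F (r • (θ : EuclideanSpace ℝ (Fin 2))))).im /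
        (conj c * w g (F (r • (θ : EuclideanSpace ℝ (Fin 2))))).re := fun r hr =>
    pageSlope_seam_belt_eq D bX Ψ hpage hRw c j v θ hr.1 hr.2
  have h0eq : Th ((0 : ℝ) • (v : EuclideanSpace ℝ (Fin 2))) =
      (conj c * w g (F ((0 : ℝ) • (θ : EuclideanSpace ℝ (Fin 2))))).im /
        (conj c * w g (F ((0 : ℝ) • (θ : EuclideanSpace ℝ (Fin 2))))).re := by
    rw [zero_smul, zero_smul, hF0]
    show (conj c * w g (Γ 0)).im / (conj c * w g (Γ 0)).re = _
    rw [hw0', (hKc v).2, (conj_mul_ray hc t₀).1, (conj_mul_ray hc t₀).2, (conj_mul_half_self hc).1,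
      (conj_mul_half_self hc).2, zero_div, zero_div]
  -- (d) one-sided uniqueness on `(0, ∞)`
  have hW1 : HasDerivWithinAt (fun r : ℝ => Th (r • (v : EuclideanSpace ℝ (Fin 2))))
      (fderiv ℝ Th 0 (v : EuclideanSpace ℝ (Fin 2))) (Ioi 0) 0 := hrayd.hasDerivWithinAt
  have hW2 : HasDerivWithinAt (fun r : ℝ => Th (r • (v : EuclideanSpace ℝ (Fin 2))))
      (4 * (‖dPhiX g ((h j).attachingCircle v).1‖ ^ 2 + ‖dPhiY ((h j).attachingCircle v).1‖ ^ 2) *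
        inner ℝ (fderiv ℝ F 0 (θ : EuclideanSpace ℝ (Fin 2))) (horizNormal g ((h j).attachingCircle v).1))
      (Ioi 0) 0 := by
    refine hT.hasDerivWithinAt.congr_of_eventuallyEq ?_ h0eq
    have hmem : Ioo (0 : ℝ) 1 ∈ 𝓝[Ioi (0 : ℝ)] 0 := Ioo_mem_nhdsGT one_pos
    filter_upwards [hmem] with r hr
    exact hagree r hr
  have e1 := hW1.derivWithin (uniqueDiffWithinAt_Ioi 0)
  have e2 := hW2.derivWithin (uniqueDiffWithinAt_Ioi 0)
  exact e1.symm.trans e2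

/-! ## §2 The belt matrix -/

/-- A bilinear pairing on `ℝ²` read on unit vectors: if `B u` is a linear functional for every `u` and
`u ↦ B u v` is additive and homogeneous, then `B u v = ⟪M u, v⟫` for one `M : ℝ² →L ℝ²`. [folklore] -/
theorem exists_clm_of_bilinear
    (B : EuclideanSpace ℝ (Fin 2) → EuclideanSpace ℝ (Fin 2) →L[ℝ] ℝ)
    (hadd : ∀ u u', B (u + u') = B u + B u') (hsmul : ∀ (t : ℝ) u, B (t • u) = t • B u) :
    ∃ M : EuclideanSpace ℝ (Fin 2) →L[ℝ] EuclideanSpace ℝ (Fin 2),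
      ∀ u v, B u v = inner ℝ (M u) v := by
  -- `B` as a linear map into the dual, composed with the Riesz isomorphism
  let L : EuclideanSpace ℝ (Fin 2) →ₗ[ℝ] (EuclideanSpace ℝ (Fin 2) →L[ℝ] ℝ) :=
    { toFun := B, map_add' := hadd, map_smul' := fun t u => hsmul t u }
  let Lc : EuclideanSpace ℝ (Fin 2) →L[ℝ] (EuclideanSpace ℝ (Fin 2) →L[ℝ] ℝ) :=
    LinearMap.toContinuousLinearMap L
  refine ⟨((InnerProductSpace.toDual ℝ (EuclideanSpace ℝ (Fin 2))).symm :
      (EuclideanSpace ℝ (Fin 2) →L[ℝ] ℝ) →L[ℝ] EuclideanSpace ℝ (Fin 2)).comp Lc, fun u v => ?_⟩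
  show B u v = inner ℝ ((InnerProductSpace.toDual ℝ (EuclideanSpace ℝ (Fin 2))).symm (B u)) v
  rw [InnerProductSpace.toDual_symm_apply]

/-- **The belt matrix** (brick H4-1).  Under the page clause, with the attaching circle `K` of handle `j`
in the flat page of direction `c`, `R₁` a smooth positive `w`-rescaling and the RAY condition at every
belt-circle point, there is ONE `M : ℝ² →L ℝ²` such that for all belt-circle points `θ` and unit `v`

  `dΘ̂_θ (0) · v = ⟪M θ, v⟫ = 4 ‖dΦ_{K v}‖² ⟪D_v θ, n (K v)⟫`.

(The sphere side makes `v ↦ 4 ‖dΦ‖² ⟪D_v θ, n⟫` linear — it is `dΘ̂_θ (0)` —, the tube side makes it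
linear in `θ` — `D_v` is a derivative.) [cite: EtnyreFuller2006, Thm. 1 (proof, p. 8)] -/
theorem exists_beltMatrix
    (hpage : ∀ (y : bX.carrier) (a : ↥(coresComplement h)), bX.incl y = D.jA a →
      ∃ c : ℝ, 0 < c ∧ w g ((bBase g).incl (Ψ y)).1 = (c : ℂ) * w g (a : Base g).1)
    (j : ι) {c : ℂ} (hc : ‖c‖ = 1) (hKc : ∀ v, (h j).attachingCircle v ∈ page g c)
    {R₁ : Base g → Base g} (hR₁ : ContMDiff (𝓡∂ 4) (𝓡∂ 4) ∞ R₁)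
    (hRw : ∀ x : Base g, ∃ t : ℝ, 0 < t ∧ w g (R₁ x).1 = (t : ℂ) * w g x.1)
    (hray : ∀ θ : sphere (0 : EuclideanSpace ℝ (Fin 2)) 1, ∃ t : ℝ, 0 < t ∧
      w g (R₁ ((BoundaryManifold.boundaryData 3 (Base g)).incl (seamDiffeo bX (bBase g) Ψ
        ((beltMap D j).boundaryTube.toHomeo (θ, (0 : EuclideanSpace ℝ (Fin 2))))))).1 = (t : ℂ) * c) :
    ∃ M : EuclideanSpace ℝ (Fin 2) →L[ℝ] EuclideanSpace ℝ (Fin 2),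
      (∀ θ v : sphere (0 : EuclideanSpace ℝ (Fin 2)) 1,
        fderiv ℝ (fun m : EuclideanSpace ℝ (Fin 2) =>
          (conj c * w g (R₁ ((BoundaryManifold.boundaryData 3 (Base g)).incl (seamDiffeo bX (bBase g) Ψ
            ((beltMap D j).boundaryTube.toHomeo (θ, m))))).1).im /
          (conj c * w g (R₁ ((BoundaryManifold.boundaryData 3 (Base g)).incl (seamDiffeo bX (bBase g) Ψ
            ((beltMap D j).boundaryTube.toHomeo (θ, m))))).1).re) 0 (v : EuclideanSpace ℝ (Fin 2)) =
        inner ℝ (M (θ : EuclideanSpace ℝ (Fin 2))) (v : EuclideanSpace ℝ (Fin 2))) ∧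
      (∀ (θ : EuclideanSpace ℝ (Fin 2)) (v : sphere (0 : EuclideanSpace ℝ (Fin 2)) 1),
        inner ℝ (M θ) (v : EuclideanSpace ℝ (Fin 2)) =
          4 * (‖dPhiX g ((h j).attachingCircle v).1‖ ^ 2 + ‖dPhiY ((h j).attachingCircle v).1‖ ^ 2) *
            inner ℝ (fderiv ℝ (fun m' : EuclideanSpace ℝ (Fin 2) => ((h j).toFun (depthLine v m' 0)).1) 0 θ)
              (horizNormal g ((h j).attachingCircle v).1)) := by
  -- the tube-side functional `u ↦ 4N ⟪D_v u, n⟫` for a unit `v`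
  let N : sphere (0 : EuclideanSpace ℝ (Fin 2)) 1 → ℝ := fun v =>
    4 * (‖dPhiX g ((h j).attachingCircle v).1‖ ^ 2 + ‖dPhiY ((h j).attachingCircle v).1‖ ^ 2)
  let Dv : sphere (0 : EuclideanSpace ℝ (Fin 2)) 1 → EuclideanSpace ℝ (Fin 2) →L[ℝ] EuclideanSpace ℝ (Fin 4) :=
    fun v => fderiv ℝ (fun m' : EuclideanSpace ℝ (Fin 2) => ((h j).toFun (depthLine v m' 0)).1) 0
  let T : sphere (0 : EuclideanSpace ℝ (Fin 2)) 1 → EuclideanSpace ℝ (Fin 2) →L[ℝ] ℝ := fun v =>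
    (N v) • ((innerSL ℝ (horizNormal g ((h j).attachingCircle v).1)).comp (Dv v))
  have hT : ∀ v (u : EuclideanSpace ℝ (Fin 2)), T v u = N v * inner ℝ (Dv v u) (horizNormal g ((h j).attachingCircle v).1) := by
    intro v u
    show N v • (inner ℝ (horizNormal g ((h j).attachingCircle v).1) (Dv v u)) = _
    rw [smul_eq_mul, real_inner_comm]
  -- the sphere-side functional `ℓ_θ = dΘ̂_θ (0)` for a unit `θ`, and its values on unit `v`
  let ell : sphere (0 : EuclideanSpace ℝ (Fin 2)) 1 → EuclideanSpace ℝ (Fin 2) →L[ℝ] ℝ := fun θ =>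
    fderiv ℝ (fun m : EuclideanSpace ℝ (Fin 2) =>
      (conj c * w g (R₁ ((BoundaryManifold.boundaryData 3 (Base g)).incl (seamDiffeo bX (bBase g) Ψ
        ((beltMap D j).boundaryTube.toHomeo (θ, m))))).1).im /
      (conj c * w g (R₁ ((BoundaryManifold.boundaryData 3 (Base g)).incl (seamDiffeo bX (bBase g) Ψ
        ((beltMap D j).boundaryTube.toHomeo (θ, m))))).1).re) 0
  have hell : ∀ θ v : sphere (0 : EuclideanSpace ℝ (Fin 2)) 1,
      ell θ (v : EuclideanSpace ℝ (Fin 2)) = T v (θ : EuclideanSpace ℝ (Fin 2)) := by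
    intro θ v
    rw [hT]
    exact fderiv_beltSlope_radial_of_ray D bX Ψ hpage j hc hKc hR₁ hRw θ v (hray θ)
  -- the bilinear form `B u := u₀ • ℓ_{e₀} + u₁ • ℓ_{e₁}` (linear in `u` by construction; on unit `v` it is
  -- the tube-side functional `T v u`, linear in `u`, so `B θ = ℓ_θ` for unit `θ`)
  have he0 : (EuclideanSpace.single (0 : Fin 2) (1 : ℝ)) ∈ sphere (0 : EuclideanSpace ℝ (Fin 2)) 1 := by
    simp
  have he1 : (EuclideanSpace.single (1 : Fin 2) (1 : ℝ)) ∈ sphere (0 : EuclideanSpace ℝ (Fin 2)) 1 := by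
    simp
  set e₀ : sphere (0 : EuclideanSpace ℝ (Fin 2)) 1 := ⟨_, he0⟩ with he₀
  set e₁ : sphere (0 : EuclideanSpace ℝ (Fin 2)) 1 := ⟨_, he1⟩ with he₁
  let B : EuclideanSpace ℝ (Fin 2) → EuclideanSpace ℝ (Fin 2) →L[ℝ] ℝ := fun u =>
    u 0 • ell e₀ + u 1 • ell e₁
  have hBadd : ∀ u u', B (u + u') = B u + B u' := by
    intro u u'
    show (u + u') 0 • ell e₀ + (u + u') 1 • ell e₁ = (u 0 • ell e₀ + u 1 • ell e₁) + (u' 0 • ell e₀ + u' 1 • ell e₁)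
    simp only [PiLp.add_apply, add_smul]
    abel
  have hBsmul : ∀ (t : ℝ) u, B (t • u) = t • B u := by
    intro t u
    show (t • u) 0 • ell e₀ + (t • u) 1 • ell e₁ = t • (u 0 • ell e₀ + u 1 • ell e₁)
    simp only [PiLp.smul_apply, smul_eq_mul, smul_add, mul_smul]
  obtain ⟨M, hM⟩ := exists_clm_of_bilinear B hBadd hBsmul
  -- on unit `v`, `B u v = T v u` (both linear in `u`, equal on the basis)
  have hdecomp : ∀ u : EuclideanSpace ℝ (Fin 2),
      u = u 0 • (e₀ : EuclideanSpace ℝ (Fin 2)) + u 1 • (e₁ : EuclideanSpace ℝ (Fin 2)) := by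
    intro u
    ext i
    fin_cases i <;> simp [he₀, he₁]
  have hBT : ∀ (u : EuclideanSpace ℝ (Fin 2)) (v : sphere (0 : EuclideanSpace ℝ (Fin 2)) 1),
      B u (v : EuclideanSpace ℝ (Fin 2)) = T v u := by
    intro u v
    change u 0 * ell e₀ (v : EuclideanSpace ℝ (Fin 2)) + u 1 * ell e₁ (v : EuclideanSpace ℝ (Fin 2)) = T v u
    rw [hell e₀ v, hell e₁ v]
    conv_rhs => rw [hdecomp u]
    rw [map_add, map_smul, map_smul, smul_eq_mul, smul_eq_mul]
  -- for unit `θ`, `B θ = ell θ` (two linear functionals agreeing on the unit circle)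
  have hBell : ∀ θ : sphere (0 : EuclideanSpace ℝ (Fin 2)) 1, B (θ : EuclideanSpace ℝ (Fin 2)) = ell θ := by
    intro θ
    have hunit : ∀ v : sphere (0 : EuclideanSpace ℝ (Fin 2)) 1,
        B (θ : EuclideanSpace ℝ (Fin 2)) (v : EuclideanSpace ℝ (Fin 2)) = ell θ (v : EuclideanSpace ℝ (Fin 2)) := by
      intro v; rw [hBT, hell]
    ext v
    by_cases hv : v = 0
    · rw [hv, map_zero, map_zero]
    · have hn : ‖v‖ ≠ 0 := norm_ne_zero_iff.2 hv
      have hvmem : (‖v‖⁻¹ : ℝ) • v ∈ sphere (0 : EuclideanSpace ℝ (Fin 2)) 1 := by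
        rw [mem_sphere_zero_iff_norm, norm_smul, norm_inv, norm_norm, inv_mul_cancel₀ hn]
      have h1 := hunit ⟨_, hvmem⟩
      simp only [map_smul, smul_eq_mul] at h1
      exact mul_left_cancel₀ (inv_ne_zero hn) h1
  refine ⟨M, fun θ v => ?_, fun θ v => ?_⟩
  · show ell θ (v : EuclideanSpace ℝ (Fin 2)) = _
    rw [← hBell θ, hM]
  · rw [← hM, hBT, hT]

/-! ## §3 Non-degeneracy of the belt matrix through a page tube -/

/-- **The rows of the belt matrix do not vanish**: with Z4's page tube `Φ` around the attaching circle
(clauses `hΦcore`, `hΦder` of `helper_exists_pageTube`, rate `κ ≠ 0`), for every unit `v` the functional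
`u ↦ 4 ‖dΦ_{K v}‖² ⟪D_v u, n (K v)⟫ = κ (A(v) u)₁` is non-zero, `A(v) = CircleTube.fibreDeriv f♭ Φ v`
being invertible. [cite: Kosinski1993, III (3.1)] -/
theorem beltRow_ne_zero (f : HandleAttachingMap 3 2 (Base g)) {c : ℂ} (hc : ‖c‖ = 1)
    (hKc : ∀ θ, f.attachingCircle θ ∈ page g c) {κ r : ℝ} (hκ : κ ≠ 0) {Φ : CircleTube (bBase g).carrier}
    (hΦcore : ∀ ψ, (bBase g).incl (Φ.core ψ) = f.attachingCircle ψ)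
    (hΦder : ∀ t : ℝ, HasFDerivAt (fun v : EuclideanSpace ℝ (Fin 2) =>
        ((bBase g).incl (Φ.toHomeo (circlePt t, v))).1)
      ((EuclideanSpace.proj (𝕜 := ℝ) (0 : Fin 2)).smulRight (r • cplxJ (deriv (ambCurve g f.attachingCircle) t)) +
        (EuclideanSpace.proj (𝕜 := ℝ) (1 : Fin 2)).smulRight (κ • rotField g (f.attachingCircle (circlePt t)).1)) 0)
    (t : ℝ) : ∃ u : EuclideanSpace ℝ (Fin 2),
      4 * (‖dPhiX g (f.attachingCircle (circlePt t)).1‖ ^ 2 + ‖dPhiY (f.attachingCircle (circlePt t)).1‖ ^ 2) *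
        inner ℝ (fderiv ℝ (fun v : EuclideanSpace ℝ (Fin 2) => (f.toFun (depthLine (circlePt t) v 0)).1) 0 u)
          (horizNormal g (f.attachingCircle (circlePt t)).1) ≠ 0 := by
  have hcore : ∀ θ, f.boundaryTube.core θ = Φ.core θ := boundaryTube_core_eq_of_incl_core f hΦcore
  have hinj := CircleTube.injective_fibreDeriv hcore (circlePt t)
  -- an injective endomorphism of `ℝ²` is onto: hit `e₁`
  have hsurj : Surjective (CircleTube.fibreDeriv f.boundaryTube Φ (circlePt t)) := by
    have h := LinearMap.injective_iff_surjective
      (f := ((CircleTube.fibreDeriv f.boundaryTube Φ (circlePt t) : EuclideanSpace ℝ (Fin 2) →L[ℝ]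
        EuclideanSpace ℝ (Fin 2)) : EuclideanSpace ℝ (Fin 2) →ₗ[ℝ] EuclideanSpace ℝ (Fin 2)))
    exact h.1 hinj
  obtain ⟨u, hu⟩ := hsurj (EuclideanSpace.single (1 : Fin 2) (1 : ℝ))
  refine ⟨u, ?_⟩
  have h1 : (CircleTube.fibreDeriv f.boundaryTube Φ (circlePt t) u) 1 = 1 := by
    rw [hu]; simp
  rw [beltRow_eq_pageTube f hc hKc hΦcore hΦder t u, h1, mul_one]
  exact hκ

/-- **Sub-goal `helper_beltMatrix_nondegenerate` of stub `stub_M2geo`** (N1 ▸ `node_N1_move` ▸ (d) N1-mono,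
brick H4-1; wave 7, lead c5).  THE BELT MATRIX IS INVERTIBLE: for a fibred model `(D, bX, Ψ)` with the
page clause, a handle `j` with attaching circle in the flat page of direction `c`, a smooth positive
`w`-rescaling `R₁` and the ray condition `w (R₁ (seam (β♭ (θ, 0)))) ∈ ℝ_{>0} c` at every belt-circle point,
there is an INJECTIVE `M : ℝ² →L ℝ²` with `dΘ̂_θ (0) · v = ⟪M θ, v⟫` for all belt-circle points `θ` and unit
`v` — the boundary open book of `X` read through the seam is a submersion along the belt circle, with the
linear deep-belt model `⟪M θ, m⟫`. [cite: EtnyreFuller2006, Thm. 1 (proof, p. 8)] -/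
theorem helper_beltMatrix_nondegenerate : ∀ (g : ℕ) (ι : Type) [Finite ι] (h : ι → Literature.Topology.FourManifolds.HandleAttachingMap 3 2 (Literature.Topology.FourManifolds.LefschetzBase.Base g)) (X : Type) [TopologicalSpace X] [ChartedSpace (EuclideanHalfSpace 4) X] [IsManifold (𝓡∂ 4) ∞ X] (D : Literature.Topology.FourManifolds.HandleAttachingMap.MultiAttachmentData h (𝓡∂ 4) X) (bX : Literature.Topology.FourManifolds.BoundaryData (𝓡∂ 4) X (𝓡 3)) (Ψ : bX.carrier ≃ₘ⟮𝓡 3, 𝓡 3⟯ (Literature.Topology.FourManifolds.LefschetzBase.bBase g).carrier), (∀ (y : bX.carrier) (a : ↥(Literature.Topology.FourManifolds.HandleAttachingMap.coresComplement h)), bX.incl y = D.jA a → ∃ c : ℝ, 0 < c ∧ Literature.Topology.FourManifolds.LefschetzBase.w g ((Literature.Topology.FourManifolds.LefschetzBase.bBase g).incl (Ψ y)).1 = (c : ℂ) * Literature.Topology.FourManifolds.LefschetzBase.w g (a : Literature.Topology.FourManifolds.LefschetzBase.Base g).1) → ∀ (j : ι) (c : ℂ), ‖c‖ = 1 → (∀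 v, (h j).attachingCircle v ∈ Literature.Topology.FourManifolds.LefschetzBase.page g c) → ∀ (R₁ : Literature.Topology.FourManifolds.LefschetzBase.Base g → Literature.Topology.FourManifolds.LefschetzBase.Base g), ContMDiff (𝓡∂ 4) (𝓡∂ 4) ∞ R₁ → (∀ x : Literature.Topology.FourManifolds.LefschetzBase.Base g, ∃ t : ℝ, 0 < t ∧ Literature.Topology.FourManifolds.LefschetzBase.w g (R₁ x).1 = (t : ℂ) * Literature.Topology.FourManifolds.LefschetzBase.w g x.1) → (∀ θ : Metric.sphere (0 : EuclideanSpace ℝ (Fin 2)) 1, ∃ t : ℝ, 0 < t ∧ Literature.Topology.FourManifolds.LefschetzBase.w g (R₁ ((Literature.Topology.FourManifolds.BoundaryManifold.boundaryData 3 (Literature.Topology.FourManifolds.LefschetzBase.Base g)).incl (Summit.SmoothPoincare4.SmoothPoincare4.Theorems.AcyclicBisectionExists.ModpBraidOrbits.seamDiffeo bX (Literature.Topology.FourManifolds.LefschetzBase.bBase g) Ψ ((Summit.SmoothPoincare4.SmoothPoincare4.Theorems.AcyclicBisectionExists.ModpBraidOrbits.beltMap D j).boundaryTube.toHomeo (θ,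 (0 : EuclideanSpace ℝ (Fin 2))))))).1 = (t : ℂ) * c) → ∃ M : EuclideanSpace ℝ (Fin 2) →L[ℝ] EuclideanSpace ℝ (Fin 2), Function.Injective M ∧ ∀ θ v : Metric.sphere (0 : EuclideanSpace ℝ (Fin 2)) 1, fderiv ℝ (fun m : EuclideanSpace ℝ (Fin 2) => ((starRingEnd ℂ) c * Literature.Topology.FourManifolds.LefschetzBase.w g (R₁ ((Literature.Topology.FourManifolds.BoundaryManifold.boundaryData 3 (Literature.Topology.FourManifolds.LefschetzBase.Base g)).incl (Summit.SmoothPoincare4.SmoothPoincare4.Theorems.AcyclicBisectionExists.ModpBraidOrbits.seamDiffeo bX (Literature.Topology.FourManifolds.LefschetzBase.bBase g) Ψ ((Summit.SmoothPoincare4.SmoothPoincare4.Theorems.AcyclicBisectionExists.ModpBraidOrbits.beltMap D j).boundaryTube.toHomeo (θ, m))))).1).im / ((starRingEnd ℂ) c * Literature.Topology.FourManifolds.LefschetzBase.w g (R₁ ((Literature.Topology.FourManifolds.BoundaryManifold.boundaryData 3 (Literature.Topology.FourManifolds.LefschetzBase.Base g)).incl (Summit.SmoothPoincare4.SmoothPoincare4.Theorems.AcyclicBisectionExists.ModpBraidOrbits.seamDiffeo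 bX (Literature.Topology.FourManifolds.LefschetzBase.bBase g) Ψ ((Summit.SmoothPoincare4.SmoothPoincare4.Theorems.AcyclicBisectionExists.ModpBraidOrbits.beltMap D j).boundaryTube.toHomeo (θ, m))))).1).re) 0 (v : EuclideanSpace ℝ (Fin 2)) = inner ℝ (M (θ : EuclideanSpace ℝ (Fin 2))) (v : EuclideanSpace ℝ (Fin 2)) := by
  intro g ι _ h X _ _ _ D bX Ψ hpage j c hc hKc R₁ hR₁ hRw hray
  obtain ⟨M, hM, hMT⟩ := exists_beltMatrix D bX Ψ hpage j hc hKc hR₁ hRw hray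
  refine ⟨M, ?_, hM⟩
  -- Z4's page tube around the attaching circle
  obtain ⟨κ, r, R, θfl, Φ, hκ, -, -, -, -, -, -, -, -, -, hΦcore, -, -, hΦder⟩ :=
    helper_exists_pageTube g c (h j).attachingCircle hc (isSmoothEmbedding_attachingCircle (h j)) hKc
  -- every unit `v` pairs non-trivially with `range M`; hence `M` is onto, hence one-to-one
  have hpair : ∀ v : EuclideanSpace ℝ (Fin 2), v ≠ 0 → ∃ u, inner ℝ (M u) v ≠ 0 := by
    intro v hv
    -- write `v = ‖v‖ • circlePt t`
    have hn : ‖v‖ ≠ 0 := norm_ne_zero_iff.2 hv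
    have hvmem : (‖v‖⁻¹ : ℝ) • v ∈ sphere (0 : EuclideanSpace ℝ (Fin 2)) 1 := by
      rw [mem_sphere_zero_iff_norm, norm_smul, norm_inv, norm_norm, inv_mul_cancel₀ hn]
    set t : ℝ := angA (⟨_, hvmem⟩ : sphere (0 : EuclideanSpace ℝ (Fin 2)) 1) with ht_def
    have ht : circlePt t = (⟨_, hvmem⟩ : sphere (0 : EuclideanSpace ℝ (Fin 2)) 1) := circlePt_angA _
    obtain ⟨u, hu⟩ := beltRow_ne_zero (h j) hc hKc hκ.ne' hΦcore hΦder t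
    refine ⟨u, fun h0 => hu ?_⟩
    rw [← hMT u (circlePt t), ht]
    show inner ℝ (M u) ((‖v‖⁻¹ : ℝ) • v) = 0
    rw [inner_smul_right, h0, mul_zero]
  have hsurj : Surjective M := by
    have horth : (LinearMap.range (M : EuclideanSpace ℝ (Fin 2) →ₗ[ℝ] EuclideanSpace ℝ (Fin 2)))ᗮ = ⊥ := by
      rw [Submodule.eq_bot_iff]
      intro v hv
      by_contra hv0
      obtain ⟨u, hu⟩ := hpair v hv0
      exact hu (Submodule.inner_right_of_mem_orthogonal (LinearMap.mem_range_self _ u) hv)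
    have hrange : LinearMap.range (M : EuclideanSpace ℝ (Fin 2) →ₗ[ℝ] EuclideanSpace ℝ (Fin 2)) = ⊤ :=
      Submodule.orthogonal_eq_bot_iff.1 horth
    exact LinearMap.range_eq_top.1 hrange
  exact (LinearMap.injective_iff_surjective
    (f := (M : EuclideanSpace ℝ (Fin 2) →ₗ[ℝ] EuclideanSpace ℝ (Fin 2)))).2 hsurj

end Summit.SmoothPoincare4.SmoothPoincare4.Theorems.AcyclicBisectionExists.ModpBraidOrbits

end
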